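import Summits.QuantumFields.BalabanUV.Beta.RowD1JointEnd
import Summits.QuantumFields.BalabanUV.Beta.AxialDressingRootedBmHessian
import Summits.QuantumFields.BalabanUV.Beta.FP.RoadRebasedHoldsBm
import Summits.QuantumFields.BalabanUV.Beta.D1BFx.ShellRoadEndMean

/-!
# `BalabanUV.Beta.D1BFx.RoadEndRowPinned` — road «BF-x» for binder row D1, sub-row «D1-BFx-MEAN-PIN»: THE ALL-SCALES (`hall`) SUPPLIER AND THE
# MEAN-GRADING ENDS FOR THE LITERAL OF RECORD `RowD1JointEnd.JsRowD1Pin` (an2's X-an2-51: the Π_bm-co-dressed RECURSIVE family (E)), SOCKETED ON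
# EXACTLY THE (E)-FAMILY S- AND W-SLOT ROWS OF ROW G-an2-4 — the K-slot DISCHARGED BY NAME

HONEST DEPENDENCY (page 1, mandatory): continuum YM on T⁴ ⇐ BetaPertH ∧ nine spine estimates (0/9 proved); BetaPertH ⇐ (D1) ∧ (D4) ∧
CAP+tail; G-an2-4 gates asym, D1 and NE2/3/4.  HONEST FRAMING (cell contract, verbatim): «discharging `BetaPertH` makes Bałaban's UV
stability UNCONDITIONAL — a real constructive-QFT result; it is NOT the continuum limit and NOT the Clay problem.»  THIS MODULE DISCHARGES
NOTHING of the wall: [folklore] composition BY NAME of an2's dressed-kernel identity `AxialDressingRooted.TbalOf_dressBmAt`, road FP's K-side merge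
`FP.RoadRebasedHoldsBm.exists_bm_rows_of_slots` (= gan24-p1's `KSlotAssembly.convCKWall_holds` ⨾ asym1's `HessKerConvCKPlug.exists_merged_rows` ⨾
`HessKerCoDressedBmWall.exists_coDressedBm_unit_rows`), asym1's four-family END `HessKerFourFamily.allScalesSeq_secondMoment_TbalOf_four_lim` at the
constructed limits (`HessKerDressedLimit`), and this road's C2 ENDs `RoadEnd.d1Drift_iff_cesaro` ∕ `d1Drift_of_meanRoad` ∕ `d1Drift_of_meanRoad_table` ∕
`ShellRoadEndMean.d1Drift_of_meanRoad_table_shell`.  EVERY S-∕W-slot row, (B1_mean), (T_mean) and every leg row below is a HYPOTHESIS with free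
constants; the one-shot coefficient `c` is FREE.  No `def`, no `Prop` minted, nothing printed asserted, 0 sorry; 0∕4 binders of row D1 (hW, hR, D1Tel,
D1Rep) instantiated; NOT D1, NOT `BetaPertH`, NOT continuum, NOT Clay.

ABSOLUTE RULE (cell charter, verbatim): «No internally-minted statement may enter as a cited fact. Every hypothesis is either kernel-proved in
this package or a verbatim quotation of a PUBLISHED theorem with page reference. The manuscript(s) under audit are NOT citable for their own
disputed steps — they are the thing under adjudication; programme-internal (2001/route/tribunal) claims are never citable.»

WHY (owner d1-p2-g4, skeleton v1.10 §(2), `LEAVES-BFx.md` INTEGRATION #9: «a MEAN twin for `JsRowD1Pin` needs its own `hall` (all-scales bound)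
supplier»).  `RoadEndPinned` (p220307) served the SUPERSEDED Π_root literal `JsBalAn1Ctr`, whose `hall` is gan24-p1's END #4 — a theorem because the K-,
S- AND W-slots of row G-an2-4 are ALL proved for that family.  FINDING-INFO «MEAN-PIN-HALL» (journal, this unit gen 6): for the literal of record
`JsRowD1Pin = JsRecWAtOf … = fun j ↦ dressBmAt ρ_c (JsRec0AtOf … j)` (co-dressed resolvents `G_j = coDressKBmAt ρ_c Lc (KInvStep Lc j)`, recursive
stencils `SrecAt`, tables `WrecAt`) row G-an2-4 stands at K ✓ ∕ S ✗ ∕ W ✗ (gan24-p1 `SKELETON-SREC.md` v0.2, PART V: the ENDs «SrecShape» ∧ «SrecRate» and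
their W-twins are DESIGN).  So NO hypothesis-free `hall` exists today; this file delivers the supplier SOCKETED on exactly those rows (PART V V6's
binder shapes, adopted units `sfStep Lc` ∕ `smStep 3 Lc`, each slot at its own rate and radius), with the K-slot discharged, and the MEAN ENDs on the
same socket.  When gan24's PART V lands, `hS`∕`hSall`∕`hW`∕`hWall` below are fed BY NAME and the ENDs become as hypothesis-light as `RoadEndPinned`.

CONTENT (`d + 1 = 4`).
* §1 (any `Lc ≥ 1`, any in-block root `r`, any `(cE, cVH, cΛ)`, any second-order tables `W`): `TbalOf_JsRecBmAtOf_codressedBm(_unit)` — the four-family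
  closed form of an2's recursive block-mean family `SpineRooted.JsRecBmAtOf` over the co-dressed resolvents with the UNDRESSED `SrecAt … j` ∕ `W j`;
  **`exists_allScalesSeq_JsRecBmAtOf_of_slots`** (`2 ≤ Lc`): S-∕W-slot rows ⟹ `∃ κ θ, 0 ≤ θ < 1 ∧ AllScalesSeq (j ↦ secondMoment (TbalOf Lc (JsRecBmAtOf …) j) μ ν) κ θ`.
* §2 the literal of record (odd `Lc`, centred root, pins `(cE, cVH, cE₂) = (Lc⁴, −Lc⁸∕2, Lc⁸)`, `T_W = (8N²)⁻¹ • wsym22 N`, an1's `vh₂SAn1 Lc` ∕ `mixFFAt ρ_c Lc`):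
  `TbalOf_JsRowD1_codressedBm`, **`exists_allScalesSeq_JsRowD1_of_slots`**, **`exists_allScalesSeq_JsRowD1Pin_of_slots`** — road BF-x's `hall`∕`hθ0`∕`hθ1`
  binders for `JsRowD1 hLc N cΛ cB` ∕ `JsRowD1Pin hLc N` ⟸ the S-∕W-slot rows of family (E) (FP's `RoadRowD1Slots.JsRowD1Undressed_S∕_W` are the same
  presentations by `rfl`).
* §3 the MEAN ENDs on that socket: `d1Drift_JsRowD1Pin_iff_cesaro_of_slots` (for the literal of record the wall's term IS a Cesàro statement),
  `d1Drift_JsRowD1Pin_of_meanRoad_of_slots` ((B1_mean) ∧ (T_mean)), `d1Drift_JsRowD1_of_meanRoad_table_of_slots` (T_mean in the table currency, an3's six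
  pointwise rows), `d1Drift_JsRowD1Pin_of_meanRoad_table_shell_of_slots` (table currency, the SHELL far rows h2s∕d2s OF RECORD, ruling ρ-g4-1).
The colour parameter `Nc : ℝ` of `D1Drift` is FREE against the `SU(N)` of `T_W` ((P6) is the leads').  (B1_mean) against O1-Bm's `shotCoeffPin`
(`FirstStepPinned`) is the row's `D1Tel` in Cesàro form — displayed, NOT proved.  Unit `b2b-balaban-beta-d1-formalise-leaf-03` (gen 6), D1 formalisation
swarm; claim table `HOME/b2b-balaban-beta-d1-p2/LEAVES-BFx.md` sub-row «D1-BFx-MEAN-PIN».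
-/

open Finset Filter Topology
open scoped BigOperators
open Literature.Probability.LatticeModels (annulus)
open Literature.MathematicalPhysics.QuantumFieldTheory
open Literature.MathematicalPhysics.QuantumFieldTheory.Balaban1983to89
open Literature.MathematicalPhysics.QuantumFieldTheory.Balaban1983to89.Beta
open RemainderConstAllScales (AllScalesSeq)
open ExpKernelCalculus (MKer Decays VertexFamily₂ hessKer)
open AffineAveraging (box toSite)
open AveragingContoursRooted (ctrOff ctrOff_mem_box)
open AveragingMixedJetTables (mixFFAt)
open OneStepResolventKernel (Fib LocStencil JetData)
open OneStepKernelFamily (vertexOfK KInvStep TbalOf D1Drift)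
open WilsonVertex2Sym (wsym22)
open WindowIdentification (fullSum)
open DyadicShell (Pt supNorm)
open SquareTable (stK)
open GhostTable (gFree)
open BubbleTransfer (unitVec)
open HessKerDressedLimit (limMKerOf limStOf limTabOf decays_limMKerOf decays_sub_limMKerOf locStencil_limStOf locStencil_sub_limStOf
  vertexFamily₂_limTabOf vertexFamily₂_sub_limTabOf)
open Summit.QuantumFields.BalabanUV.Beta.HessKerDressedUnits (unitK unitS unitW)
open Summit.QuantumFields.BalabanUV.Beta.HessKerFourFamily (hessKer_four_unit allScalesSeq_secondMoment_TbalOf_four_lim)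
open Summit.QuantumFields.BalabanUV.Beta.AxialDressingRooted (coDressKBmAt dressBmAt TbalOf_dressBmAt)
open Summit.QuantumFields.BalabanUV.Beta.SpineRooted (JsRec0AtOf JsRec0AtOf_S JsRec0AtOf_W JsRecBmAtOf JsRecWAtOf JsRecWAtOf_eq WrecAt)
open Summit.QuantumFields.BalabanUV.Beta.WardLocusRecursive (SrecAt)
open Summit.QuantumFields.BalabanUV.Beta.SecondOrderSocketIdentification (vh₂SAn1)
open Summit.QuantumFields.BalabanUV.Beta.RowD1JointEnd (JsRowD1 JsRowD1Pin JsRowD1_eq JsRowD1Pin_eq)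
open Summit.QuantumFields.BalabanUV.Beta.GAN24.CombesThomas (sfStep smStep sfStep_ne_zero smStep_ne_zero)
open Summit.QuantumFields.BalabanUV.Beta.FP.RoadRebasedHoldsBm (exists_bm_rows_of_slots)
open Summit.QuantumFields.BalabanUV.Beta.D1BFx.RoadEnd (d1Drift_iff_cesaro d1Drift_of_meanRoad d1Drift_of_meanRoad_table)
open Summit.QuantumFields.BalabanUV.Beta.D1BFx.ShellRoadEndMean (d1Drift_of_meanRoad_table_shell)

namespace Summit.QuantumFields.BalabanUV.Beta.D1BFx.RoadEndRowPinned

noncomputable section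

/-! ## §1 The recursive block-mean family: four-family closed form and the all-scales bound from the S- and W-slot rows -/

section RecBm

variable {Lc : ℕ} [NeZero Lc] (hLc : 1 ≤ Lc) {r : Fin (3 + 1) → ℕ} (hr : r ∈ box (3 + 1) Lc) (cE cVH cΛ : ℝ)
  (W : ℕ → Fin (3 + 1) → (Fin (3 + 1) → ℤ) → Fin (3 + 1) → (Fin (3 + 1) → ℤ) → MKer (3 + 1) (Fib 3))
  (Cw' δw : ℕ → ℝ) (hδw : ∀ j, 0 < δw j) (hW' : ∀ j, VertexFamily₂ (W j) Lc (Cw' j) (δw j)) {Cs cS δS θS Cw cW δW θW : ℝ}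

/-- [folklore] **THE FOUR-FAMILY CLOSED FORM OF an2's RECURSIVE BLOCK-MEAN FAMILY** (`SpineRooted.JsRecBmAtOf = fun j ↦ dressBmAt ρ (JsRec0AtOf … j)`):
`TbalOf Lc (JsRecBmAtOf …) j = hessKer G_j (vertexOfK G_j Lc (SrecAt 3 Lc (toSite r) cE cVH cΛ j)) (W j)`, `G_j = coDressKBmAt (toSite r) Lc (KInvStep Lc j)`
— an2's `TbalOf_dressBmAt` with the undressed tables read off by `rfl` (`JsRec0AtOf_S` ∕ `JsRec0AtOf_W`). -/
theorem TbalOf_JsRecBmAtOf_codressedBm (j : ℕ) :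
    TbalOf Lc (JsRecBmAtOf hLc hr cE cVH cΛ W Cw' δw hδw hW') j =
      hessKer (coDressKBmAt (toSite r) Lc (KInvStep (d := 3) Lc j))
        (vertexOfK (coDressKBmAt (toSite r) Lc (KInvStep (d := 3) Lc j)) Lc (SrecAt 3 Lc (toSite r) cE cVH cΛ j)) (W j) := by
  unfold SpineRooted.JsRecBmAtOf
  rw [TbalOf_dressBmAt, JsRec0AtOf_S, JsRec0AtOf_W]

/-- [folklore] **THE SAME IN ANY NONZERO LEG UNITS** (`HessKerFourFamily.hessKer_four_unit`): the member `j` as a four-family form on the RESCALED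
co-dressed resolvent `D_j G_j D_j`, the rescaled undressed stencils `unitS_j (SrecAt … j)` and tables `unitW_j (W j)`. -/
theorem TbalOf_JsRecBmAtOf_codressedBm_unit (sf sm : ℕ → ℝ) (hsf : ∀ j, sf j ≠ 0) (hsm : ∀ j, sm j ≠ 0) (j : ℕ) :
    TbalOf Lc (JsRecBmAtOf hLc hr cE cVH cΛ W Cw' δw hδw hW') j =
      hessKer (unitK (sf j) (sm j) (coDressKBmAt (toSite r) Lc (KInvStep (d := 3) Lc j)))
        (vertexOfK (unitK (sf j) (sm j) (coDressKBmAt (toSite r) Lc (KInvStep (d := 3) Lc j))) Lc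
          (unitS (sf j) (sm j) (SrecAt 3 Lc (toSite r) cE cVH cΛ j)))
        (unitW (sf j) (sm j) (W j)) := by
  rw [TbalOf_JsRecBmAtOf_codressedBm hLc hr cE cVH cΛ W Cw' δw hδw hW' j]
  exact (hessKer_four_unit (hsf j) (hsm j) Lc _ _ _ _).symm

/-- [folklore] **THE SCALAR ALL-SCALES BOUND OF THE STEP COEFFICIENTS OF THE RECURSIVE BLOCK-MEAN FAMILY FROM THE S- AND W-SLOT ROWS ALONE**
(`d = 3`, `2 ≤ Lc`, in-block root, adopted units `sfStep Lc` ∕ `smStep 3 Lc`): `j`-uniform rows + all-scales Cauchy deviations of the rescaled UNDRESSED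
recursive stencils `unitS_j (SrecAt … j)` (rate `θS`, radius `δS`) and of the rescaled tables `unitW_j (W j)` (rate `θW`, radius `δW`) ⟹
`∃ κ θ, 0 ≤ θ < 1 ∧ AllScalesSeq (j ↦ secondMoment (TbalOf Lc (JsRecBmAtOf …) j) μ ν) κ θ`.  K-side DISCHARGED: the co-dressed rescaled resolvents' rows
and the merged window ∕ rate are road FP's `RoadRebasedHoldsBm.exists_bm_rows_of_slots` (gan24-p1's `convCKWall_holds` inside); the scalar form is asym1's
`HessKerFourFamily.allScalesSeq_secondMoment_TbalOf_four_lim` at the constructed limits (`HessKerDressedLimit`).  The S-∕W-rows are HYPOTHESES. -/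
theorem exists_allScalesSeq_JsRecBmAtOf_of_slots (hLc2 : 2 ≤ Lc)
    (hS : ∀ j, LocStencil (unitS (sfStep Lc j) (smStep 3 Lc j) (SrecAt 3 Lc (toSite r) cE cVH cΛ j)) Cs δS)
    (hSall : ∀ k j, LocStencil (unitS (sfStep Lc (k + j)) (smStep 3 Lc (k + j)) (SrecAt 3 Lc (toSite r) cE cVH cΛ (k + j)) -
      unitS (sfStep Lc k) (smStep 3 Lc k) (SrecAt 3 Lc (toSite r) cE cVH cΛ k)) (cS * θS ^ k) δS)
    (hW : ∀ j, VertexFamily₂ (unitW (sfStep Lc j) (smStep 3 Lc j) (W j)) Lc Cw δW)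
    (hWall : ∀ k j, VertexFamily₂ (unitW (sfStep Lc (k + j)) (smStep 3 Lc (k + j)) (W (k + j)) - unitW (sfStep Lc k) (smStep 3 Lc k) (W k)) Lc
      (cW * θW ^ k) δW)
    (hδS : 0 < δS) (hδW : 0 < δW) (hθS0 : 0 ≤ θS) (hθS1 : θS < 1) (hθW0 : 0 ≤ θW) (hθW1 : θW < 1) (μ ν : Fin 4) :
    ∃ κ θ : ℝ, 0 ≤ θ ∧ θ < 1 ∧
      AllScalesSeq (fun j => B12Beta.secondMoment (TbalOf Lc (JsRecBmAtOf hLc hr cE cVH cΛ W Cw' δw hδw hW') j) μ ν) κ θ := by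
  obtain ⟨C, δK, cK, θ, R, hR, hRK, hRS, hRW, hθ0, hθ1, hG, hGall, hSall', hWall'⟩ :=
    exists_bm_rows_of_slots (Lc := Lc) hLc2 hr
      (S := fun j => unitS (sfStep Lc j) (smStep 3 Lc j) (SrecAt 3 Lc (toSite r) cE cVH cΛ j))
      (W := fun j => unitW (sfStep Lc j) (smStep 3 Lc j) (W j)) hSall hWall hδS hδW hθS0 hθS1 hθW0 hθW1
  exact ⟨_, θ, hθ0, hθ1, allScalesSeq_secondMoment_TbalOf_four_lim (JsRecBmAtOf hLc hr cE cVH cΛ W Cw' δw hδw hW')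
    (A := fun j => unitK (sfStep Lc j) (smStep 3 Lc j) (coDressKBmAt (toSite r) Lc (KInvStep (d := 3) Lc j)))
    (K := fun j => unitK (sfStep Lc j) (smStep 3 Lc j) (coDressKBmAt (toSite r) Lc (KInvStep (d := 3) Lc j)))
    (S := fun j => unitS (sfStep Lc j) (smStep 3 Lc j) (SrecAt 3 Lc (toSite r) cE cVH cΛ j))
    (W := fun j => unitW (sfStep Lc j) (smStep 3 Lc j) (W j))
    (Ainf := limMKerOf fun j => unitK (sfStep Lc j) (smStep 3 Lc j) (coDressKBmAt (toSite r) Lc (KInvStep (d := 3) Lc j)))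
    (Kinf := limMKerOf fun j => unitK (sfStep Lc j) (smStep 3 Lc j) (coDressKBmAt (toSite r) Lc (KInvStep (d := 3) Lc j)))
    (Sinf := limStOf fun j => unitS (sfStep Lc j) (smStep 3 Lc j) (SrecAt 3 Lc (toSite r) cE cVH cΛ j))
    (Winf := limTabOf fun j => unitW (sfStep Lc j) (smStep 3 Lc j) (W j))
    (TbalOf_JsRecBmAtOf_codressedBm_unit hLc hr cE cVH cΛ W Cw' δw hδw hW' (sfStep Lc) (smStep 3 Lc) sfStep_ne_zero smStep_ne_zero)
    hG (decays_limMKerOf hG hGall hθ1) (decays_sub_limMKerOf hGall hθ1)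
    hG (decays_limMKerOf hG hGall hθ1) (decays_sub_limMKerOf hGall hθ1)
    hS (locStencil_limStOf hS hSall' hθ1) (locStencil_sub_limStOf hSall' hθ1)
    hW (vertexFamily₂_limTabOf hW hWall' hθ1) (vertexFamily₂_sub_limTabOf hWall' hθ1) hR hRK hRS hRW hθ0 hθ1 μ ν⟩

end RecBm

/-! ## §2 The literal of record: closed form and the `hall` supplier from the (E)-family S- and W-slot rows -/

section Record

variable {Lc : ℕ} [NeZero Lc] {Cs cS δS θS Cw cW δW θW : ℝ}

/-- [folklore] **THE FOUR-FAMILY CLOSED FORM OF THE LITERAL OF RECORD** `JsRowD1 hLc N cΛ cB` (= `JsRecWAtOf …` = `JsRecBmAtOf … (W := WrecAt …)` by `rfl`):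
for every `j`, `TbalOf Lc (JsRowD1 …) j = hessKer G_j (vertexOfK G_j Lc S⁰_j) W⁰_j` with `G_j = coDressKBmAt ρ_c Lc (KInvStep Lc j)`,
`S⁰_j = SrecAt 3 Lc ρ_c Lc⁴ (−Lc⁸∕2) cΛ j`, `W⁰_j = WrecAt 3 Lc ρ_c Lc⁴ (−Lc⁸∕2) cΛ Lc⁸ cB T_W (vh₂SAn1 Lc) (mixFFAt ρ_c Lc) j`, `ρ_c = toSite (ctrOff 4 Lc)`
(FP's `RoadRowD1.TbalOf_JsRowD1` states the same over its name `JsRowD1Undressed`). -/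
theorem TbalOf_JsRowD1_codressedBm (hLc : Odd Lc) (N : ℕ) (cΛ cB : ℝ) (j : ℕ) :
    TbalOf Lc (JsRowD1 hLc N cΛ cB) j =
      hessKer (coDressKBmAt (toSite (ctrOff (3 + 1) Lc)) Lc (KInvStep (d := 3) Lc j))
        (vertexOfK (coDressKBmAt (toSite (ctrOff (3 + 1) Lc)) Lc (KInvStep (d := 3) Lc j)) Lc
          (SrecAt 3 Lc (toSite (ctrOff (3 + 1) Lc)) ((Lc : ℝ) ^ 4) (-((Lc : ℝ) ^ 8 / 2)) cΛ j))
        (WrecAt 3 Lc (toSite (ctrOff (3 + 1) Lc)) ((Lc : ℝ) ^ 4) (-((Lc : ℝ) ^ 8 / 2)) cΛ ((Lc : ℝ) ^ 8) cB ((8 * (N : ℝ) ^ 2)⁻¹ • wsym22 N)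
          (vh₂SAn1 Lc) (mixFFAt (toSite (ctrOff (3 + 1) Lc)) Lc) j) := by
  rw [JsRowD1_eq, JsRecWAtOf_eq]
  exact TbalOf_JsRecBmAtOf_codressedBm hLc.pos (ctrOff_mem_box hLc.pos) _ _ _ _ _ _ _ _ j

/-- [folklore] **ROAD BF-x's `hall` ∕ `hθ0` ∕ `hθ1` BINDERS FOR THE LITERAL `JsRowD1 hLc N cΛ cB` FROM THE (E)-FAMILY S- AND W-SLOT ROWS** (odd `Lc ≥ 2`, adopted
units): the S-slot rows on `unitS (sfStep Lc j) (smStep 3 Lc j) (SrecAt 3 Lc ρ_c Lc⁴ (−Lc⁸∕2) cΛ j)` and the W-slot rows on `unitW … (WrecAt 3 Lc ρ_c … j)` (each at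
its own rate ∕ radius) ⟹ `∃ κ θ, 0 ≤ θ < 1 ∧ AllScalesSeq (j ↦ secondMoment (TbalOf Lc (JsRowD1 …) j) μ ν) κ θ` — §1 at the centred root.  K-side discharged;
the four rows are HYPOTHESES (row G-an2-4, family (E): not in the tree). -/
theorem exists_allScalesSeq_JsRowD1_of_slots (hLc : Odd Lc) (hL2 : 2 ≤ Lc) (N : ℕ) (cΛ cB : ℝ)
    (hS : ∀ j, LocStencil (unitS (sfStep Lc j) (smStep 3 Lc j)
      (SrecAt 3 Lc (toSite (ctrOff (3 + 1) Lc)) ((Lc : ℝ) ^ 4) (-((Lc : ℝ) ^ 8 / 2)) cΛ j)) Cs δS)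
    (hSall : ∀ k j, LocStencil (unitS (sfStep Lc (k + j)) (smStep 3 Lc (k + j))
        (SrecAt 3 Lc (toSite (ctrOff (3 + 1) Lc)) ((Lc : ℝ) ^ 4) (-((Lc : ℝ) ^ 8 / 2)) cΛ (k + j)) -
      unitS (sfStep Lc k) (smStep 3 Lc k) (SrecAt 3 Lc (toSite (ctrOff (3 + 1) Lc)) ((Lc : ℝ) ^ 4) (-((Lc : ℝ) ^ 8 / 2)) cΛ k)) (cS * θS ^ k) δS)
    (hW : ∀ j, VertexFamily₂ (unitW (sfStep Lc j) (smStep 3 Lc j)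
      (WrecAt 3 Lc (toSite (ctrOff (3 + 1) Lc)) ((Lc : ℝ) ^ 4) (-((Lc : ℝ) ^ 8 / 2)) cΛ ((Lc : ℝ) ^ 8) cB ((8 * (N : ℝ) ^ 2)⁻¹ • wsym22 N)
        (vh₂SAn1 Lc) (mixFFAt (toSite (ctrOff (3 + 1) Lc)) Lc) j)) Lc Cw δW)
    (hWall : ∀ k j, VertexFamily₂ (unitW (sfStep Lc (k + j)) (smStep 3 Lc (k + j))
        (WrecAt 3 Lc (toSite (ctrOff (3 + 1) Lc)) ((Lc : ℝ) ^ 4) (-((Lc : ℝ) ^ 8 / 2)) cΛ ((Lc : ℝ) ^ 8) cB ((8 * (N : ℝ) ^ 2)⁻¹ • wsym22 N)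
          (vh₂SAn1 Lc) (mixFFAt (toSite (ctrOff (3 + 1) Lc)) Lc) (k + j)) -
      unitW (sfStep Lc k) (smStep 3 Lc k)
        (WrecAt 3 Lc (toSite (ctrOff (3 + 1) Lc)) ((Lc : ℝ) ^ 4) (-((Lc : ℝ) ^ 8 / 2)) cΛ ((Lc : ℝ) ^ 8) cB ((8 * (N : ℝ) ^ 2)⁻¹ • wsym22 N)
          (vh₂SAn1 Lc) (mixFFAt (toSite (ctrOff (3 + 1) Lc)) Lc) k)) Lc (cW * θW ^ k) δW)
    (hδS : 0 < δS) (hδW : 0 < δW) (hθS0 : 0 ≤ θS) (hθS1 : θS < 1) (hθW0 : 0 ≤ θW) (hθW1 : θW < 1) (μ ν : Fin 4) :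
    ∃ κ θ : ℝ, 0 ≤ θ ∧ θ < 1 ∧ AllScalesSeq (fun j => B12Beta.secondMoment (TbalOf Lc (JsRowD1 hLc N cΛ cB) j) μ ν) κ θ := by
  rw [JsRowD1_eq, JsRecWAtOf_eq]
  exact exists_allScalesSeq_JsRecBmAtOf_of_slots hLc.pos (ctrOff_mem_box hLc.pos) _ _ _ _ _ _ _ _ hL2 hS hSall hW hWall hδS hδW hθS0 hθS1
    hθW0 hθW1 μ ν

/-- [folklore] **ROAD BF-x's `hall` ∕ `hθ0` ∕ `hθ1` BINDERS FOR THE LITERAL OF RECORD `JsRowD1Pin hLc N`** (`cΛ := 2∕Lc⁴`, `cB := −Lc¹²∕4`; odd `Lc ≥ 2`):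
the (E)-family S-∕W-slot rows at the pinned constants ⟹ `∃ κ θ, 0 ≤ θ < 1 ∧ AllScalesSeq (j ↦ β⁰_j) κ θ`, `β⁰_j := secondMoment (TbalOf Lc (JsRowD1Pin hLc N) j) μ ν`.
The twin, for the literal of record, of gan24-p1's END #4 `allScalesSeq_secondMoment_JsBalAn1Ctr_pinned` — CONDITIONAL on the four rows (S ✗ ∕ W ✗ for (E)). -/
theorem exists_allScalesSeq_JsRowD1Pin_of_slots (hLc : Odd Lc) (hL2 : 2 ≤ Lc) (N : ℕ)
    (hS : ∀ j, LocStencil (unitS (sfStep Lc j) (smStep 3 Lc j)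
      (SrecAt 3 Lc (toSite (ctrOff (3 + 1) Lc)) ((Lc : ℝ) ^ 4) (-((Lc : ℝ) ^ 8 / 2)) (2 / (Lc : ℝ) ^ 4) j)) Cs δS)
    (hSall : ∀ k j, LocStencil (unitS (sfStep Lc (k + j)) (smStep 3 Lc (k + j))
        (SrecAt 3 Lc (toSite (ctrOff (3 + 1) Lc)) ((Lc : ℝ) ^ 4) (-((Lc : ℝ) ^ 8 / 2)) (2 / (Lc : ℝ) ^ 4) (k + j)) -
      unitS (sfStep Lc k) (smStep 3 Lc k)
        (SrecAt 3 Lc (toSite (ctrOff (3 + 1) Lc)) ((Lc : ℝ) ^ 4) (-((Lc : ℝ) ^ 8 / 2)) (2 / (Lc : ℝ) ^ 4) k)) (cS * θS ^ k) δS)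
    (hW : ∀ j, VertexFamily₂ (unitW (sfStep Lc j) (smStep 3 Lc j)
      (WrecAt 3 Lc (toSite (ctrOff (3 + 1) Lc)) ((Lc : ℝ) ^ 4) (-((Lc : ℝ) ^ 8 / 2)) (2 / (Lc : ℝ) ^ 4) ((Lc : ℝ) ^ 8) (-((Lc : ℝ) ^ 12 / 4))
        ((8 * (N : ℝ) ^ 2)⁻¹ • wsym22 N) (vh₂SAn1 Lc) (mixFFAt (toSite (ctrOff (3 + 1) Lc)) Lc) j)) Lc Cw δW)
    (hWall : ∀ k j, VertexFamily₂ (unitW (sfStep Lc (k + j)) (smStep 3 Lc (k + j))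
        (WrecAt 3 Lc (toSite (ctrOff (3 + 1) Lc)) ((Lc : ℝ) ^ 4) (-((Lc : ℝ) ^ 8 / 2)) (2 / (Lc : ℝ) ^ 4) ((Lc : ℝ) ^ 8) (-((Lc : ℝ) ^ 12 / 4))
          ((8 * (N : ℝ) ^ 2)⁻¹ • wsym22 N) (vh₂SAn1 Lc) (mixFFAt (toSite (ctrOff (3 + 1) Lc)) Lc) (k + j)) -
      unitW (sfStep Lc k) (smStep 3 Lc k)
        (WrecAt 3 Lc (toSite (ctrOff (3 + 1) Lc)) ((Lc : ℝ) ^ 4) (-((Lc : ℝ) ^ 8 / 2)) (2 / (Lc : ℝ) ^ 4) ((Lc : ℝ) ^ 8) (-((Lc : ℝ) ^ 12 / 4))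
          ((8 * (N : ℝ) ^ 2)⁻¹ • wsym22 N) (vh₂SAn1 Lc) (mixFFAt (toSite (ctrOff (3 + 1) Lc)) Lc) k)) Lc (cW * θW ^ k) δW)
    (hδS : 0 < δS) (hδW : 0 < δW) (hθS0 : 0 ≤ θS) (hθS1 : θS < 1) (hθW0 : 0 ≤ θW) (hθW1 : θW < 1) (μ ν : Fin 4) :
    ∃ κ θ : ℝ, 0 ≤ θ ∧ θ < 1 ∧ AllScalesSeq (fun j => B12Beta.secondMoment (TbalOf Lc (JsRowD1Pin hLc N) j) μ ν) κ θ :=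
  exists_allScalesSeq_JsRowD1_of_slots hLc hL2 N _ _ hS hSall hW hWall hδS hδW hθS0 hθS1 hθW0 hθW1 μ ν

end Record

/-! ## §3 The MEAN-grading ENDs for the literal of record on the S-∕W-slot socket -/

section Mean

variable {Lc : ℕ} [NeZero Lc] {κB : Type*} {Cs cS δS θS Cw cW δW θW : ℝ} (hLc : Odd Lc) (hL2 : 2 ≤ Lc) (N : ℕ)
  (hS : ∀ j, LocStencil (unitS (sfStep Lc j) (smStep 3 Lc j)
    (SrecAt 3 Lc (toSite (ctrOff (3 + 1) Lc)) ((Lc : ℝ) ^ 4) (-((Lc : ℝ) ^ 8 / 2)) (2 / (Lc : ℝ) ^ 4) j)) Cs δS)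
  (hSall : ∀ k j, LocStencil (unitS (sfStep Lc (k + j)) (smStep 3 Lc (k + j))
      (SrecAt 3 Lc (toSite (ctrOff (3 + 1) Lc)) ((Lc : ℝ) ^ 4) (-((Lc : ℝ) ^ 8 / 2)) (2 / (Lc : ℝ) ^ 4) (k + j)) -
    unitS (sfStep Lc k) (smStep 3 Lc k)
      (SrecAt 3 Lc (toSite (ctrOff (3 + 1) Lc)) ((Lc : ℝ) ^ 4) (-((Lc : ℝ) ^ 8 / 2)) (2 / (Lc : ℝ) ^ 4) k)) (cS * θS ^ k) δS)
  (hW : ∀ j, VertexFamily₂ (unitW (sfStep Lc j) (smStep 3 Lc j)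
    (WrecAt 3 Lc (toSite (ctrOff (3 + 1) Lc)) ((Lc : ℝ) ^ 4) (-((Lc : ℝ) ^ 8 / 2)) (2 / (Lc : ℝ) ^ 4) ((Lc : ℝ) ^ 8) (-((Lc : ℝ) ^ 12 / 4))
      ((8 * (N : ℝ) ^ 2)⁻¹ • wsym22 N) (vh₂SAn1 Lc) (mixFFAt (toSite (ctrOff (3 + 1) Lc)) Lc) j)) Lc Cw δW)
  (hWall : ∀ k j, VertexFamily₂ (unitW (sfStep Lc (k + j)) (smStep 3 Lc (k + j))
      (WrecAt 3 Lc (toSite (ctrOff (3 + 1) Lc)) ((Lc : ℝ) ^ 4) (-((Lc : ℝ) ^ 8 / 2)) (2 / (Lc : ℝ) ^ 4) ((Lc : ℝ) ^ 8) (-((Lc : ℝ) ^ 12 / 4))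
        ((8 * (N : ℝ) ^ 2)⁻¹ • wsym22 N) (vh₂SAn1 Lc) (mixFFAt (toSite (ctrOff (3 + 1) Lc)) Lc) (k + j)) -
    unitW (sfStep Lc k) (smStep 3 Lc k)
      (WrecAt 3 Lc (toSite (ctrOff (3 + 1) Lc)) ((Lc : ℝ) ^ 4) (-((Lc : ℝ) ^ 8 / 2)) (2 / (Lc : ℝ) ^ 4) ((Lc : ℝ) ^ 8) (-((Lc : ℝ) ^ 12 / 4))
        ((8 * (N : ℝ) ^ 2)⁻¹ • wsym22 N) (vh₂SAn1 Lc) (mixFFAt (toSite (ctrOff (3 + 1) Lc)) Lc) k)) Lc (cW * θW ^ k) δW)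
  (hδS : 0 < δS) (hδW : 0 < δW) (hθS0 : 0 ≤ θS) (hθS1 : θS < 1) (hθW0 : 0 ≤ θW) (hθW1 : θW < 1)
include hL2 hS hSall hW hWall hδS hδW hθS0 hθS1 hθW0 hθW1

/-- [folklore] **FOR THE LITERAL OF RECORD THE WALL's TERM IS A CESÀRO STATEMENT ⟸ THE (E)-FAMILY S-∕W-SLOT ROWS**: every channel `(μ, ν)`, every colour
parameter `Nc`: `D1Drift Lc (JsRowD1Pin hLc N) Nc μ ν ⟺ (Σ_{j<m} β⁰_j)∕m → stepBal Nc Lc` (`RoadEnd.d1Drift_iff_cesaro` at §2's `hall`).  The twin of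
`RoadEndPinned.d1Drift_JsBalAn1Ctr_iff_cesaro_pinned`, CONDITIONAL on the four rows. -/
theorem d1Drift_JsRowD1Pin_iff_cesaro_of_slots (μ ν : Fin 4) (Nc : ℝ) :
    D1Drift Lc (JsRowD1Pin hLc N) Nc μ ν ↔
      Tendsto (fun m : ℕ => (∑ j ∈ range m, B12Beta.secondMoment (TbalOf Lc (JsRowD1Pin hLc N) j) μ ν) / (m : ℝ)) atTop
        (𝓝 (B12Normalization.stepBal Nc Lc)) := by
  obtain ⟨κ, θ, hθ0, hθ1, hall⟩ := exists_allScalesSeq_JsRowD1Pin_of_slots hLc hL2 N hS hSall hW hWall hδS hδW hθS0 hθS1 hθW0 hθW1 μ ν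
  exact d1Drift_iff_cesaro _ hall hθ0 hθ1 Nc

/-- [folklore] **THE MEAN ROAD END FOR THE LITERAL OF RECORD ⟸ THE (E)-FAMILY S-∕W-SLOT ROWS**: (B1_mean) a Cesàro-null telescoping defect of the step
coefficients of `JsRowD1Pin` against a one-shot coefficient `c (Lc^m)` (free; O1-Bm's `FirstStepPinned.shotCoeffPin` is the intended instance, and then
(B1_mean) is the row's `D1Tel` in Cesàro form) ∧ (T_mean) `c (Lc^m)∕m → stepBal Nc Lc` ⟹ `D1Drift Lc (JsRowD1Pin hLc N) Nc μ ν` (`RoadEnd.d1Drift_of_meanRoad`).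
The twin of `RoadEndPinned.d1Drift_JsBalAn1Ctr_of_meanRoad_pinned`, CONDITIONAL on the four rows. -/
theorem d1Drift_JsRowD1Pin_of_meanRoad_of_slots (μ ν : Fin 4) (Nc : ℝ) (c : ℕ → ℝ)
    (hB1 : Tendsto (fun m : ℕ => ((∑ j ∈ range m, B12Beta.secondMoment (TbalOf Lc (JsRowD1Pin hLc N) j) μ ν) - c (Lc ^ m)) / (m : ℝ))
      atTop (𝓝 0))
    (hT : Tendsto (fun m : ℕ => c (Lc ^ m) / (m : ℝ)) atTop (𝓝 (B12Normalization.stepBal Nc Lc))) :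
    D1Drift Lc (JsRowD1Pin hLc N) Nc μ ν := by
  obtain ⟨κ, θ, hθ0, hθ1, hall⟩ := exists_allScalesSeq_JsRowD1Pin_of_slots hLc hL2 N hS hSall hW hWall hδS hδW hθS0 hθS1 hθW0 hθW1 μ ν
  exact d1Drift_of_meanRoad _ hall hθ0 hθ1 Nc c hB1 hT

/-- [folklore] **THE MEAN ROAD END FOR THE LITERAL OF RECORD, TABLE CURRENCY, POINTWISE ROWS ⟸ THE (E)-FAMILY S-∕W-SLOT ROWS**: (B1_mean), the MEAN target
`(c (Lc^m) − Σ_b wt·fullSum (stK μ ν Nc (Gf (Lc^m) b)))∕m → 0` over a scalar leg family `Gf` with convex base-point weights, and an3's six graded scalar rows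
`h0∕h1∕h2∕d0∕d1∕d2` for `Gf` ⟹ `D1Drift Lc (JsRowD1Pin hLc N) Nc μ ν` (`RoadEnd.d1Drift_of_meanRoad_table`).  The twin of
`RoadEndPinned.d1Drift_JsBalAn1Ctr_of_meanRoad_table_pinned`, CONDITIONAL on the four rows. -/
theorem d1Drift_JsRowD1Pin_of_meanRoad_table_of_slots {μ ν : Fin 4} (hμν : μ ≠ ν) {Nc : ℝ} (hNc : Nc ≠ 0) (c : ℕ → ℝ)
    {Bset : ℕ → Finset κB} {wt : ℕ → κB → ℝ} {Gf : ℕ → κB → Pt → ℝ} {D A : ℕ → ℝ}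
    (hD : ∀ j, 0 ≤ D j) (hA : ∀ j, 0 ≤ A j) {δ : ℝ} (hδ : 0 < δ)
    (hwt0 : ∀ n : ℕ, 2 ≤ n → ∀ b ∈ Bset n, 0 ≤ wt n b) (hwt1 : ∀ n : ℕ, 2 ≤ n → ∑ b ∈ Bset n, wt n b = 1)
    (h0 : ∀ n : ℕ, 2 ≤ n → ∀ b ∈ Bset n, ∀ v, |Gf n b v - gFree v| ≤ D 0 / (n : ℝ) ^ 2)
    (h1 : ∀ n : ℕ, 2 ≤ n → ∀ b ∈ Bset n, ∀ v (ρ : Fin 4),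
      |(Gf n b (v + unitVec ρ) - gFree (v + unitVec ρ)) - (Gf n b v - gFree v)| ≤ D 1 / (n : ℝ) ^ 3)
    (h2 : ∀ n : ℕ, 2 ≤ n → ∀ b ∈ Bset n, ∀ v,
      |(Gf n b (v + unitVec ν + unitVec μ) - gFree (v + unitVec ν + unitVec μ)) - (Gf n b (v + unitVec ν) - gFree (v + unitVec ν)) -
          (Gf n b (v + unitVec μ) - gFree (v + unitVec μ)) + (Gf n b v - gFree v)| ≤ D 2 / (n : ℝ) ^ 4)
    (d0 : ∀ n : ℕ, 2 ≤ n → ∀ b ∈ Bset n, ∀ v : Pt, v ≠ 0 → |Gf n b v| ≤ A 0 * Real.exp (-(δ / n) * supNorm v) / (supNorm v : ℝ) ^ 2)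
    (d1 : ∀ n : ℕ, 2 ≤ n → ∀ b ∈ Bset n, ∀ v : Pt, v ≠ 0 → ∀ ρ : Fin 4,
      |Gf n b (v + unitVec ρ) - Gf n b v| ≤ A 1 * Real.exp (-(δ / n) * supNorm v) / (supNorm v : ℝ) ^ 3)
    (d2 : ∀ n : ℕ, 2 ≤ n → ∀ b ∈ Bset n, ∀ v : Pt, v ≠ 0 →
      |Gf n b (v + unitVec ν + unitVec μ) - Gf n b (v + unitVec ν) - Gf n b (v + unitVec μ) + Gf n b v| ≤
        A 2 * Real.exp (-(δ / n) * supNorm v) / (supNorm v : ℝ) ^ 4)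
    (hB1 : Tendsto (fun m : ℕ => ((∑ j ∈ range m, B12Beta.secondMoment (TbalOf Lc (JsRowD1Pin hLc N) j) μ ν) - c (Lc ^ m)) / (m : ℝ))
      atTop (𝓝 0))
    (hT : Tendsto (fun m : ℕ => (c (Lc ^ m) - ∑ b ∈ Bset (Lc ^ m), wt (Lc ^ m) b * fullSum (stK μ ν Nc (Gf (Lc ^ m) b))) / (m : ℝ))
      atTop (𝓝 0)) :
    D1Drift Lc (JsRowD1Pin hLc N) Nc μ ν := by
  obtain ⟨κ, θ, hθ0, hθ1, hall⟩ := exists_allScalesSeq_JsRowD1Pin_of_slots hLc hL2 N hS hSall hW hWall hδS hδW hθS0 hθS1 hθW0 hθW1 μ ν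
  exact d1Drift_of_meanRoad_table _ hμν hNc hL2 hall hθ0 hθ1 c hD hA hδ hwt0 hwt1 h0 h1 h2 d0 d1 d2 hB1 hT

/-- [folklore] **THE MEAN ROAD END FOR THE LITERAL OF RECORD, TABLE CURRENCY, SHELL FAR ROWS OF RECORD (ruling ρ-g4-1) ⟸ THE (E)-FAMILY S-∕W-SLOT ROWS**:
as the previous END with the same-leg mixed second-difference rows h2∕d2 replaced by their SHELL-ℓ¹ forms `h2s` (`Σ_{‖v‖∞=r+1} |D_{μν}(Gf − gFree)(v)| ≤ D₂∕n`,
`r + 1 ≤ n`) and `d2s` (`Σ_{‖v‖∞=r+1} |D_{μν}Gf(v)| ≤ A₂e^{−(δ∕n)(r+1)}∕(r+1)`, `r ≥ n`) — `ShellRoadEndMean.d1Drift_of_meanRoad_table_shell` at §2's `hall`.  The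
twin of `ShellRoadEndMean.d1Drift_JsBalAn1Ctr_of_meanRoad_table_pinned_shell`, CONDITIONAL on the four rows. -/
theorem d1Drift_JsRowD1Pin_of_meanRoad_table_shell_of_slots {μ ν : Fin 4} (hμν : μ ≠ ν) {Nc : ℝ} (hNc : Nc ≠ 0) (c : ℕ → ℝ)
    {Bset : ℕ → Finset κB} {wt : ℕ → κB → ℝ} {Gf : ℕ → κB → Pt → ℝ} {D A : ℕ → ℝ}
    (hD : ∀ j, 0 ≤ D j) (hA : ∀ j, 0 ≤ A j) {δ : ℝ} (hδ : 0 < δ)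
    (hwt0 : ∀ n : ℕ, 2 ≤ n → ∀ b ∈ Bset n, 0 ≤ wt n b) (hwt1 : ∀ n : ℕ, 2 ≤ n → ∑ b ∈ Bset n, wt n b = 1)
    (h0 : ∀ n : ℕ, 2 ≤ n → ∀ b ∈ Bset n, ∀ v, |Gf n b v - gFree v| ≤ D 0 / (n : ℝ) ^ 2)
    (h1 : ∀ n : ℕ, 2 ≤ n → ∀ b ∈ Bset n, ∀ v (ρ : Fin 4),
      |(Gf n b (v + unitVec ρ) - gFree (v + unitVec ρ)) - (Gf n b v - gFree v)| ≤ D 1 / (n : ℝ) ^ 3)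
    (h2s : ∀ n : ℕ, 2 ≤ n → ∀ b ∈ Bset n, ∀ r : ℕ, r + 1 ≤ n →
      ∑ v ∈ annulus 4 r (r + 1), |(Gf n b (v + unitVec ν + unitVec μ) - gFree (v + unitVec ν + unitVec μ)) -
          (Gf n b (v + unitVec ν) - gFree (v + unitVec ν)) - (Gf n b (v + unitVec μ) - gFree (v + unitVec μ)) +
          (Gf n b v - gFree v)| ≤ D 2 / (n : ℝ))
    (d0 : ∀ n : ℕ, 2 ≤ n → ∀ b ∈ Bset n, ∀ v : Pt, v ≠ 0 → |Gf n b v| ≤ A 0 * Real.exp (-(δ / n) * supNorm v) / (supNorm v : ℝ) ^ 2)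
    (d1 : ∀ n : ℕ, 2 ≤ n → ∀ b ∈ Bset n, ∀ v : Pt, v ≠ 0 → ∀ ρ : Fin 4,
      |Gf n b (v + unitVec ρ) - Gf n b v| ≤ A 1 * Real.exp (-(δ / n) * supNorm v) / (supNorm v : ℝ) ^ 3)
    (d2s : ∀ n : ℕ, 2 ≤ n → ∀ b ∈ Bset n, ∀ r : ℕ, n ≤ r →
      ∑ v ∈ annulus 4 r (r + 1), |Gf n b (v + unitVec ν + unitVec μ) - Gf n b (v + unitVec ν) - Gf n b (v + unitVec μ) + Gf n b v| ≤
        A 2 * Real.exp (-(δ / n) * ((r : ℝ) + 1)) / ((r : ℝ) + 1))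
    (hB1 : Tendsto (fun m : ℕ => ((∑ j ∈ range m, B12Beta.secondMoment (TbalOf Lc (JsRowD1Pin hLc N) j) μ ν) - c (Lc ^ m)) / (m : ℝ))
      atTop (𝓝 0))
    (hT : Tendsto (fun m : ℕ => (c (Lc ^ m) - ∑ b ∈ Bset (Lc ^ m), wt (Lc ^ m) b * fullSum (stK μ ν Nc (Gf (Lc ^ m) b))) / (m : ℝ))
      atTop (𝓝 0)) :
    D1Drift Lc (JsRowD1Pin hLc N) Nc μ ν := by
  obtain ⟨κ, θ, hθ0, hθ1, hall⟩ := exists_allScalesSeq_JsRowD1Pin_of_slots hLc hL2 N hS hSall hW hWall hδS hδW hθS0 hθS1 hθW0 hθW1 μ ν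
  exact d1Drift_of_meanRoad_table_shell _ hμν hNc hL2 hall hθ0 hθ1 c hD hA hδ hwt0 hwt1 h0 h1 h2s d0 d1 d2s hB1 hT

end Mean

end

end Summit.QuantumFields.BalabanUV.Beta.D1BFx.RoadEndRowPinned
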